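import Literature.AnabelianGeometry.SemiGraphs.TemperedAnabelianThm64SubProofs
import Literature.AnabelianGeometry.SemiGraphs.TemperedAnabelianProfiniteCompletion
import Literature.AnabelianGeometry.SemiGraphs.TemperedProfiniteProducts
import Literature.AnabelianGeometry.SemiGraphs.DOFTypeHomComposition
import Mathlib.FieldTheory.Galois.Profinite
import Mathlib.GroupTheory.SpecificGroups.Dihedral
import HarnessLib

/-!
# [SemiAnbd] Thm. 6.4 sub-DAG: the concluding inference T64-L07 `OuterDescent` is a SCHEMA
# (its universal closure over the §6 interface is false — a restricted-product datum)

S. Mochizuki, *Semi-graphs of anabelioids*, Publ. RIMS **42** (2006) [SemiAnbd], Theorem 6.4, proof,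
kurims p. 71 ll. 8–11: "this dominant morphism of schemes induces a homomorphism `ψ` … whose profinite
completion `ψ̂` differs from `φ̂` by composition with an inner automorphism of `Π_{Y_L}`.  On the other
hand, by Lemma 6.3, (iii), we thus conclude that `φ` differs from `ψ` by composition with an inner
automorphism of `Π^temp_{Y_L}`, as desired." [cite: MochizukiSemiAnbd2006, Thm 6.4 proof p.71]

PROOF-ONLY companion (theorems only; no definition, no instance, no named fact) of the sub-DAG statements
file `TemperedAnabelianThm64Sub.lean` (abc-iut-w5-d139), written for the FROZEN FACT-LIST row **F-2838**
`TemperedCurve.OuterDescent` (abc-iut cell, F fact-proving wave, tranche 171, seat abc-iut-f-171).  The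
row is the sub-node T64-L07: two DOF-type homomorphisms `φ, ψ : Π^temp_{X_K} → Π^temp_{Y_L}` that are
conjugate in `Π_{Y_L}` are conjugate in `Π^temp_{Y_L}`.  Its kernel status before this file: PROVED from
T64-L06′ (`outerDescent_of_openDenseDOFConjugator`), at every datum with `Π^temp ↠ Π`
(`outerDescent_of_toHat_surjective`) and over the André tower (`TemperedAnabelianThm64OfTowerProofs`);
its universal closure was open — the rank-one abelian datum `ℤ × G_{ℚ_p}` of
`TemperedCurveDiscreteRankOneWitness` / `TemperedAnabelianTowerNecessity`, which refutes the closures of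
Lemma 6.1 (iii), Lemma 6.3 (iii) and T64-L06′, does NOT refute T64-L07: there `N_Π(Π^temp)` acts on
`Π^temp` by INNER automorphisms (the extra normaliser is central), so outer descent holds at it.

This file records in the kernel that the universal closure of T64-L07 is nevertheless FALSE over the
interface, at a datum exhibiting the complementary phenomenon — an element of `N_Π(Π^temp)` inducing a
NON-inner automorphism of `Π^temp`:

* the datum (built inside the proof of `exists_temperedCurve_not_outerDescent`, no definition):
  `K := ℚ_p`; `S := D₃ ≅ 𝔖₃` (Mathlib's `DihedralGroup 3`, discrete); `Π := (∏_ℕ S) × G_{ℚ_p}`;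
  `Π^temp := (⊕_ℕ S) × G_{ℚ_p}`, where `⊕_ℕ S ≤ ∏_ℕ S` is the subgroup of finitely supported sequences
  WITH THE SUBSPACE TOPOLOGY (dense, so `Π^temp ↪ Π` is a profinite completion in the sense of the
  interface by abc-iut-f-092's `isProfiniteCompletion_subgroup_of_dense` and abc-iut-w5-d218's / abc-iut-w5-d240's
  `IsProfiniteCompletion.prodMap_id`); augmentation the second projection; no closed points;
* `exists_temperedCurve_not_outerDescent`: for the constant sequence `c = (σ, σ, …)`, `σ ∈ S` a
  reflection, conjugation by `(c, 1) ∈ Π` restricts to a continuous automorphism `φ` of `Π^temp` (finite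
  supports are preserved), of DOF-type (onto), `Π`-conjugate to `ψ := id` by construction, but NOT
  `Π^temp`-conjugate to `id`: a conjugator `(d, g) ∈ Π^temp` has `d_i = 1` off a finite set, and at such
  an `i` the sequence supported at `i` with value a rotation `τ` is moved by `φ` to `σ τ σ⁻¹ ≠ τ` but fixed
  by `d`.  Hence `¬ OuterDescent Y Y`; by the tree's reduction T64-L07 ⇐ T64-L06′ also
  `¬ Y.OpenDenseDOFConjugator`, and the image of `Π^temp` is normal in `Π`, so `¬ Y.PiTempNormallyTerminal`;
* `not_forall_outerDescent`, `not_forall_outerDescent_self`: the closed forms `∀ X Y, OuterDescent X Y`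
  and `∀ Y, OuterDescent Y Y` are false (FACT-LIST reading for F-2838: "universal-closure REFUTED / schema;
  instance forms conditional (`outerDescent_of_openDenseDOFConjugator`, `…_of_tower`) and model-witnessed
  (`TemperedAnabelianThm64SubCompactCase`, `…TowerWitness`)" — the row is bound per datum, exactly as the
  assemblies `temperedAnabelianTheorem_of_steps` / `_of_inputs` do).

HONEST FRAMING: a junk inhabitant of the INTERFACE `TemperedCurve p` (which records only part of the
structure of `π₁^temp` of a hyperbolic curve); nothing of [SemiAnbd] is refuted or asserted — Theorem 6.4
concerns hyperbolic curves, for which print has [André]'s tower and Lemma 6.3 (iii), and `(⊕_ℕ 𝔖₃) × G_{ℚ_p}`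
is no such group (it is not even complete, so not tempered in the sense of Def. 3.1 (i)).  Classical
topological group theory only; no side is taken on [IUTchIII] Cor. 3.12; typed ≠ proved.
-/

noncomputable section

namespace Literature.AnabelianGeometry.SemiGraphs

open _root_.Topology
open scoped Pointwise

/-! ### Finitely supported sequences are dense in a product of discrete groups -/

section FinSupp

variable {S : Type} [Group S]

/-- The finitely supported sequences are dense in `∏_ℕ S` (product topology, any topology on `S`): a
sequence is the limit of its truncations. [folklore] -/
private theorem dense_setOf_mulSupport_finite [TopologicalSpace S] :
    Dense {f : ℕ → S | (Function.mulSupport f).Finite} := by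
  intro f
  refine mem_closure_of_tendsto (f := fun n : ℕ => fun i => if i < n then f i else 1)
    (b := Filter.atTop) ?_ (Filter.Eventually.of_forall fun n => ?_)
  · rw [tendsto_pi_nhds]
    intro i
    refine (tendsto_const_nhds (x := f i)).congr' ?_
    filter_upwards [Filter.eventually_gt_atTop i] with n hn
    simp [hn]
  · show (Function.mulSupport fun i => if i < n then f i else 1).Finite
    refine (Set.finite_lt_nat n).subset fun i hi => ?_
    by_contra h
    have h' : ¬ i < n := h
    exact hi (if_neg h')

/-- A finitely supported sequence vanishes somewhere (`ℕ` is infinite). [folklore] -/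
private theorem exists_apply_eq_one_of_mulSupport_finite {f : ℕ → S}
    (hf : (Function.mulSupport f).Finite) : ∃ i, f i = 1 := by
  obtain ⟨i, -, hi⟩ := Set.infinite_univ.exists_notMem_finite hf
  exact ⟨i, Function.notMem_mulSupport.mp hi⟩

/-- Conjugation by ANY sequence preserves finite supports. [folklore] -/
private theorem mulSupport_conj_finite (c : ℕ → S) {f : ℕ → S}
    (hf : (Function.mulSupport f).Finite) : (Function.mulSupport (c * f * c⁻¹)).Finite := by
  refine hf.subset fun i hi => ?_
  rw [Function.mem_mulSupport] at hi ⊢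
  intro h
  apply hi
  simp [h]

end FinSupp

/-! ### The restricted-product datum and the failure of T64-L07 -/

section Curve

variable (p : ℕ) [Fact p.Prime]

/-- **A datum of the §6 interface at which T64-L07 `OuterDescent` FAILS.**  There is
`Y : TemperedCurve p` (`K = ℚ_p`, `Π^temp := (⊕_ℕ 𝔖₃) × G_{ℚ_p}` with the subspace topology from
`Π := (∏_ℕ 𝔖₃) × G_{ℚ_p}`, no closed points) such that the image of `Π^temp` in `Π` is NORMAL, yet some
continuous DOF-type endomorphism of `Π^temp_{Y}` is `Π_{Y}`-conjugate but not `Π^temp_{Y}`-conjugate to the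
identity: `¬ OuterDescent Y Y`; consequently (tree reduction T64-L07 ⇐ T64-L06′) `¬ Y.OpenDenseDOFConjugator`,
and `¬ Y.PiTempNormallyTerminal`. [cite: MochizukiSemiAnbd2006, Thm 6.4 proof p.71] -/
theorem exists_temperedCurve_not_outerDescent :
    ∃ Y : TemperedCurve p, Y.toHat.toMonoidHom.range.Normal ∧ ¬ Y.PiTempNormallyTerminal ∧
      ¬ Y.OpenDenseDOFConjugator ∧ ¬ TemperedCurve.OuterDescent Y Y := by
  classical
  -- `S = D₃ ≅ 𝔖₃`, discrete
  letI : TopologicalSpace (DihedralGroup 3) := ⊥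
  haveI : DiscreteTopology (DihedralGroup 3) := ⟨rfl⟩
  haveI : IsTopologicalGroup (DihedralGroup 3) :=
    { continuous_mul := continuous_of_discreteTopology
      continuous_inv := continuous_of_discreteTopology }
  haveI : IsGalois ℚ_[p] (AlgebraicClosure ℚ_[p]) := {}
  haveI : T2Space (GQp p) := krullTopology_t2
  -- `D = ⊕_ℕ S ≤ P = ∏_ℕ S`, finitely supported sequences, subspace topology
  let D : Subgroup (ℕ → DihedralGroup 3) :=
    { carrier := {f | (Function.mulSupport f).Finite}
      mul_mem' := fun {f g} hf hg => (hf.union hg).subset (Function.mulSupport_mul f g)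
      one_mem' := by simp
      inv_mem' := fun {f} hf => by
        show (Function.mulSupport f⁻¹).Finite
        rwa [Function.mulSupport_inv] }
  have hDmem : ∀ {f : ℕ → DihedralGroup 3}, f ∈ D ↔ (Function.mulSupport f).Finite := fun {f} => Iff.rfl
  let ιD : D →ₜ* (ℕ → DihedralGroup 3) := { D.subtype with continuous_toFun := continuous_subtype_val }
  have hιD : IsProfiniteCompletion ιD :=
    isProfiniteCompletion_subgroup_of_dense D dense_setOf_mulSupport_finite
  -- the datum
  let Y : TemperedCurve p :=
    { K := ⊥
      finiteDimensional_K := inferInstance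
      PiTemp := D × GQp p
      aug := ContinuousMonoidHom.snd D (GQp p)
      range_aug := by
        rw [IntermediateField.fixingSubgroup_bot]
        exact MonoidHom.range_eq_top.mpr Prod.snd_surjective
      PiHat := (ℕ → DihedralGroup 3) × GQp p
      toHat := ιD.prodMap (ContinuousMonoidHom.id (GQp p))
      isProfiniteCompletion_toHat := hιD.prodMap_id
      toHat_injective := Subtype.val_injective.prodMap Function.injective_id
      augHat := ContinuousMonoidHom.snd _ (GQp p)
      augHat_comp := fun _ => rfl
      Pt := PEmpty
      IsCusp := fun x => x.elim
      decomp := fun x => x.elim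
      isClosed_decomp := fun x => x.elim
      isOpen_aug_decomp := fun x => x.elim
      inertia_eq_bot := fun x => x.elim
      inertia_equiv_zHat := fun x => x.elim }
  -- the conjugator: the constant sequence at a reflection `σ`; `τ` a rotation not commuting with it
  let σ : DihedralGroup 3 := DihedralGroup.sr 0
  let τ : DihedralGroup 3 := DihedralGroup.r 1
  have hστ : σ * τ * σ⁻¹ ≠ τ := by decide
  let c : ℕ → DihedralGroup 3 := fun _ => σ
  -- conjugation by `c` on `D` (finite supports are preserved), a continuous automorphism
  let φD : D →ₜ* D :=
    { toFun := fun f => ⟨c * f.1 * c⁻¹, mulSupport_conj_finite c f.2⟩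
      map_one' := by ext1; simp
      map_mul' := fun f g => by
        ext1
        simp only [Subgroup.coe_mul]
        group
      continuous_toFun := by
        refine Continuous.subtype_mk ?_ _
        exact (continuous_const.mul continuous_subtype_val).mul continuous_const }
  have hφD_apply : ∀ f : D, ((φD f : D) : ℕ → DihedralGroup 3) = c * f.1 * c⁻¹ := fun _ => rfl
  let φ : Y.PiTemp →ₜ* Y.PiTemp := φD.prodMap (ContinuousMonoidHom.id (GQp p))
  have hφ_apply : ∀ x : D × GQp p, φ x = (φD x.1, x.2) := fun _ => rfl
  have hφsurj : Function.Surjective φ := by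
    rintro ⟨g, γ⟩
    refine ⟨(⟨c⁻¹ * g.1 * c⁻¹⁻¹, mulSupport_conj_finite c⁻¹ g.2⟩, γ), ?_⟩
    rw [hφ_apply]
    refine Prod.ext ?_ rfl
    ext1
    rw [hφD_apply]
    simp only [inv_inv]
    group
  -- the image of `Π^temp` is normal in `Π`
  have hnormal : Y.toHat.toMonoidHom.range.Normal := by
    refine ⟨?_⟩
    rintro _ ⟨⟨f, γ⟩, rfl⟩ ⟨a, b⟩
    refine ⟨(⟨a * f.1 * a⁻¹, mulSupport_conj_finite a f.2⟩, b * γ * b⁻¹), ?_⟩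
    rfl
  -- `toHat` is not onto (the constant sequence `c` is not finitely supported), so Lem. 6.1 (iii) fails
  have hc_not : c ∉ D := by
    intro hc
    obtain ⟨i, hi⟩ := exists_apply_eq_one_of_mulSupport_finite ((hDmem).mp hc)
    exact (by decide : σ ≠ 1) hi
  have hNT : ¬ Y.PiTempNormallyTerminal := by
    intro h
    change Subgroup.normalizer (Y.toHat.toMonoidHom.range : Set Y.PiHat) = Y.toHat.toMonoidHom.range at h
    rw [Subgroup.normalizer_eq_top_iff.2 hnormal] at h
    have hmem : ((c, (1 : GQp p)) : (ℕ → DihedralGroup 3) × GQp p) ∈ Y.toHat.toMonoidHom.range := by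
      rw [← h]; trivial
    obtain ⟨⟨f, γ⟩, hf⟩ := hmem
    apply hc_not
    have : (f : ℕ → DihedralGroup 3) = c := (Prod.mk.inj hf).1
    rw [← this]
    exact f.2
  -- T64-L07 fails
  have hOD : ¬ TemperedCurve.OuterDescent Y Y := by
    intro h
    obtain ⟨⟨d, g⟩, hy⟩ := h φ (ContinuousMonoidHom.id _) (isDOFTypeHom_of_surjective φ hφsurj)
      isDOFTypeHom_id ⟨((c, (1 : GQp p)) : (ℕ → DihedralGroup 3) × GQp p), fun x => by
        show ((c * x.1.1 * c⁻¹, x.2) : (ℕ → DihedralGroup 3) × GQp p) = (c, 1) * (x.1.1, x.2) * (c, 1)⁻¹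
        rw [Prod.inv_mk, Prod.mk_mul_mk, Prod.mk_mul_mk, inv_one, mul_one, one_mul]⟩
    -- the `D`-component `d` of the conjugator is `1` at some index `i`
    obtain ⟨i, hi⟩ := exists_apply_eq_one_of_mulSupport_finite d.2
    -- test against the sequence supported at `i` with value `τ`
    have hxmem : (Pi.mulSingle i τ : ℕ → DihedralGroup 3) ∈ D :=
      (hDmem).mpr ((Set.finite_singleton i).subset Pi.mulSupport_mulSingle_subset)
    let x : ↥D × GQp p := (⟨Pi.mulSingle i τ, hxmem⟩, 1)
    have h1 := congrArg (fun z : ↥D × GQp p => ((z.1 : ↥D) : ℕ → DihedralGroup 3) i) (hy x)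
    -- left: `σ τ σ⁻¹`; right: `d i · τ · (d i)⁻¹ = τ`
    have h2 : (c * (Pi.mulSingle i τ : ℕ → DihedralGroup 3) * c⁻¹ : ℕ → DihedralGroup 3) i =
        ((d : ℕ → DihedralGroup 3) * (Pi.mulSingle i τ : ℕ → DihedralGroup 3) *
          (d : ℕ → DihedralGroup 3)⁻¹ : ℕ → DihedralGroup 3) i := h1
    simp only [c, Pi.mul_apply, Pi.inv_apply, Pi.mulSingle_eq_same, hi, one_mul, inv_one, mul_one] at h2
    exact hστ h2
  exact ⟨Y, hnormal, hNT, fun h => hOD (Y.outerDescent_of_openDenseDOFConjugator Y h), hOD⟩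

/-- **F-2838 is a SCHEMA**: the universal closure of T64-L07 `TemperedCurve.OuterDescent` over pairs of
data of the §6 interface is FALSE (true per datum under T64-L06′: `outerDescent_of_openDenseDOFConjugator`;
over the tower; and when `Π^temp ↠ Π`). [cite: MochizukiSemiAnbd2006, Thm 6.4 proof p.71] -/
theorem not_forall_outerDescent :
    ¬ ∀ X Y : TemperedCurve p, TemperedCurve.OuterDescent X Y := fun h => by
  obtain ⟨Y, -, -, -, hY⟩ := exists_temperedCurve_not_outerDescent p
  exact hY (h Y Y)

/-- The diagonal closed form `∀ Y, OuterDescent Y Y` of F-2838 is false as well.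
[cite: MochizukiSemiAnbd2006, Thm 6.4 proof p.71] -/
theorem not_forall_outerDescent_self :
    ¬ ∀ Y : TemperedCurve p, TemperedCurve.OuterDescent Y Y := fun h => by
  obtain ⟨Y, -, -, -, hY⟩ := exists_temperedCurve_not_outerDescent p
  exact hY (h Y)

end Curve

end Literature.AnabelianGeometry.SemiGraphs

end
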